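import Summits.BirchSwinnertonDyer.BirchSwinnertonDyer.Theorems.Rank2Observatory2DescClSplitImageSound
import Summits.BirchSwinnertonDyer.BirchSwinnertonDyer.Theorems.Rank2Observatory2DescPadicRootMem
import HarnessLib

/-!
# BirchSwinnertonDyer — rank ≥ 2 observatory: KERNEL-2DESC-CL — NODAL LOCAL CONDITIONS AT AN ODD SPLIT PRIME (M4a)

HONEST FRAMING: per-curve certified theorems and census instruments; no claim on BSD in rank ≥ 2.

The per-point lemma that wires the ℓ-adic split local image (M3a/M3b, `…SplitImageTree/Class/Sound`) into the
`Cl`-certificate's sieve.  Setting: `K = ℚ(θ)` a cubic field, three ring maps `φ_i : K → ℚ_ℓ` with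
`φ_i(θ) = z_i ∈ ℤ_ℓ` and `‖z_i − a_i‖ ≤ ℓ^{−N}` (`a_i ∈ ℤ`; these are the tree's `RootedPrime` data from Hensel
certificates, `…2DescPadicRoot*`), a curve `y² = F(x) = x³ + Ax² + Bx + C` with a root `e ∈ 𝓞 K`,
`m²·e = X_t(θ)`, and a family `w_j ∈ 𝓞 K`, `m²·w_j = X_j(θ)` (`m² = m₁` of the two-view records).  For a rational
point `(x, y)`, `y ≠ 0`, and a subset `U` with `(x − e)·∏_{j∈U} w_j ∈ K^{×2}` (the shape in which the landed
`mordellWeilRank_le_of_coverSet_cl` consumes the sieve), the KERNEL-COMPUTED class vector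
`uvecOdd ℓ (X_j(a_i))_{i,j} U` — per root `i` the parities over `j ∈ U` of the two class bits of the integers
`X_j(a_i)` — lies in the kernel-computed list `splitImgOdd ℓ (X_t(a_i))_i`, provided the kernel checks
`X_t(a_i)` pairwise distinct, `nodeDepth + 1 ≤ N`, and `X_j(a_i) ≠ 0`, `v_ℓ(X_j(a_i)) < N`.
Proof: apply `φ_i`; squares die under the class map `S`; `cls(φ_i w_j)` is read off `X_j(a_i)` by local constancy
(`m²` is a square); the three `φ_i(e)` are distinct roots of `F` in `ℚ_ℓ`, so `F = ∏ (X − φ_i e)` and M3b applies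
to the scaled point `(m²x, m³y)` with the `ℤ_ℓ`-roots `X_t(z_i) = m² φ_i(e)` (no inverse of `m` is needed).
Stated over an abstract `S : SqClassMapOdd ℓ`; nothing here constructs `S` or the `φ_i`.

Sorry-free; axioms `propext`, `Classical.choice`, `Quot.sound`.
[cite: Cassels1991LecturesEllipticCurves, §15]
-/

noncomputable section

set_option linter.dupNamespace false
set_option autoImplicit false

open Polynomial NumberField Literature.NumberTheory.NumberFields

namespace Summit.BirchSwinnertonDyer.BirchSwinnertonDyer.Rank2Observatory.TwoDescCl.SplitImage

/-! ## §1 Kernel functions: the class vector of a subset (computable) -/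

/-- Parity of the number of flagged indices of `U`. [folklore] -/
def oddCard {ι : Type*} (U : Finset ι) (f : ι → Bool) : Bool :=
  decide (Odd (U.filter fun j => f j = true).card)

/-- The two class bits of a non-zero integer at an odd prime: `(v_ℓ mod 2, non-square unit part)`. [folklore] -/
def bitsInt (ℓ : ℕ) (d : ℤ) : Bool × Bool := (decide (valInt ℓ d % 2 = 1), nonsqBit ℓ (unitPart ℓ d))

/-- The class of `∏_{j∈U} w_j` at one root, from the integer table `d j = X_j(a)`. [folklore] -/
def uclsOdd (ℓ : ℕ) {ι : Type*} (d : ι → ℤ) (U : Finset ι) : Bool × Bool :=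
  (oddCard U fun j => (bitsInt ℓ (d j)).1, oddCard U fun j => (bitsInt ℓ (d j)).2)

/-- **The kernel's class vector of a subset `U`** at the three roots (6-bit mask), from the table
`d i j = X_j(a_i)`. [cite: Cassels1991LecturesEllipticCurves, §15] -/
def uvecOdd (ℓ : ℕ) {ι : Type*} (d : Fin 3 → ι → ℤ) (U : Finset ι) : ℕ :=
  vec3 (uclsOdd ℓ (d 0) U) (uclsOdd ℓ (d 1) U) (uclsOdd ℓ (d 2) U)

/-- `oddCard ∅ = false`. [folklore] -/
theorem oddCard_empty {ι : Type*} (f : ι → Bool) : oddCard (∅ : Finset ι) f = false := by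
  rw [oddCard, Finset.filter_empty, Finset.card_empty]
  decide

/-- `oddCard (insert i U) f = f i ⊕ oddCard U f`. [folklore] -/
theorem oddCard_insert {ι : Type*} [DecidableEq ι] {U : Finset ι} {i : ι} (hi : i ∉ U) (f : ι → Bool) :
    oddCard (insert i U) f = (f i != oddCard U f) := by
  unfold oddCard
  rw [Finset.filter_insert]
  by_cases hfi : f i = true
  · rw [if_pos hfi, Finset.card_insert_eq_ite, if_neg (fun h => hi (Finset.mem_of_mem_filter i h)), hfi]
    rcases Nat.even_or_odd (U.filter fun j => f j = true).card with h | h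
    · rw [decide_eq_true h.add_one, decide_eq_false (Nat.not_odd_iff_even.mpr h)]; rfl
    · rw [decide_eq_false (Nat.not_odd_iff_even.mpr h.add_one), decide_eq_true h]; rfl
  · rw [if_neg hfi, eq_false_of_ne_true hfi]
    generalize decide (Odd (U.filter fun j => f j = true).card) = b
    cases b <;> rfl

/-! ## §2 Class-map algebra -/

section Cls

variable {ℓ : ℕ} [hp : Fact ℓ.Prime]

/-- `cls 1 = 0`. [folklore] -/
theorem cls_one (S : SqClassMapOdd ℓ) : S.cls 1 = (false, false) := by
  have h := S.cls_mul 1 1 one_ne_zero one_ne_zero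
  rw [mul_one] at h
  rw [h]
  simp only [bne_self_eq_false]

/-- A square factor does not change the class. [folklore] -/
theorem cls_mul_self_mul (S : SqClassMapOdd ℓ) {u v : ℚ_[ℓ]} (hu : u ≠ 0) (hv : v ≠ 0) :
    S.cls (u * u * v) = S.cls v := by
  rw [S.cls_mul _ _ (mul_ne_zero hu hu) hv, S.cls_mul u u hu hu]
  simp only [bne_self_eq_false]
  generalize S.cls v = c
  obtain ⟨b1, b2⟩ := c
  cases b1 <;> cases b2 <;> rfl

/-- If `u·v` is a square (`u, v ≠ 0`) then `cls u = cls v`. [cite: Cassels1991LecturesEllipticCurves, §15] -/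
theorem cls_eq_of_isSquare_mul (S : SqClassMapOdd ℓ) {u v : ℚ_[ℓ]} (hu : u ≠ 0) (hv : v ≠ 0)
    (h : IsSquare (u * v)) : S.cls u = S.cls v := by
  obtain ⟨s, hs⟩ := h
  have hs0 : s ≠ 0 := by
    intro h0; rw [h0, mul_zero] at hs; exact mul_ne_zero hu hv hs
  have e1 := S.cls_mul s s hs0 hs0
  rw [← hs, S.cls_mul u v hu hv] at e1
  simp only [bne_self_eq_false, Prod.mk.injEq] at e1
  obtain ⟨e1, e2⟩ := e1
  rcases hcu : S.cls u with ⟨a1, a2⟩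
  rcases hcv : S.cls v with ⟨b1, b2⟩
  rw [hcu, hcv] at e1 e2
  revert e1 e2
  cases a1 <;> cases a2 <;> cases b1 <;> cases b2 <;> decide

/-- **Class of a product over a subset** = parities of the class bits. [folklore] -/
theorem cls_prod (S : SqClassMapOdd ℓ) {ι : Type*} [DecidableEq ι] (g : ι → ℚ_[ℓ]) (U : Finset ι)
    (hg : ∀ j ∈ U, g j ≠ 0) :
    S.cls (∏ j ∈ U, g j) = (oddCard U (fun j => (S.cls (g j)).1), oddCard U (fun j => (S.cls (g j)).2)) := by
  revert hg
  refine Finset.induction_on U (fun _ => ?_) (@fun i U hi ih => ?_)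
  · rw [Finset.prod_empty, cls_one, oddCard_empty, oddCard_empty]
  · intro hg
    have hgi : g i ≠ 0 := hg i (Finset.mem_insert_self i U)
    have hgU : ∀ j ∈ U, g j ≠ 0 := fun j hj => hg j (Finset.mem_insert_of_mem hj)
    have hprod : ∏ j ∈ U, g j ≠ 0 := Finset.prod_ne_zero_iff.mpr hgU
    rw [Finset.prod_insert hi, S.cls_mul _ _ hgi hprod, ih hgU, oddCard_insert hi, oddCard_insert hi]

end Cls

/-! ## §3 A monic cubic with three distinct roots splits -/

/-- If `e₀, e₁, e₂` are pairwise distinct roots of `X³ + AX² + BX + C` in a field, then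
`X³ + AX² + BX + C = (X − e₀)(X − e₁)(X − e₂)` (as functions). [folklore] -/
theorem cubic_eq_prod3 {F : Type*} [Field F] {A B C e₀ e₁ e₂ : F}
    (h₀ : e₀ ^ 3 + A * e₀ ^ 2 + B * e₀ + C = 0) (h₁ : e₁ ^ 3 + A * e₁ ^ 2 + B * e₁ + C = 0)
    (h₂ : e₂ ^ 3 + A * e₂ ^ 2 + B * e₂ + C = 0) (h01 : e₀ ≠ e₁) (h02 : e₀ ≠ e₂) (h12 : e₁ ≠ e₂) (t : F) :
    t ^ 3 + A * t ^ 2 + B * t + C = (t - e₀) * (t - e₁) * (t - e₂) := by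
  have g0 : (A + (e₀ + e₁ + e₂)) * e₀ ^ 2 + (B - (e₀ * e₁ + e₀ * e₂ + e₁ * e₂)) * e₀ + (C + e₀ * e₁ * e₂) = 0 := by
    linear_combination h₀
  have g1 : (A + (e₀ + e₁ + e₂)) * e₁ ^ 2 + (B - (e₀ * e₁ + e₀ * e₂ + e₁ * e₂)) * e₁ + (C + e₀ * e₁ * e₂) = 0 := by
    linear_combination h₁
  have g2 : (A + (e₀ + e₁ + e₂)) * e₂ ^ 2 + (B - (e₀ * e₁ + e₀ * e₂ + e₁ * e₂)) * e₂ + (C + e₀ * e₁ * e₂) = 0 := by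
    linear_combination h₂
  have d01 : (e₀ - e₁) * ((A + (e₀ + e₁ + e₂)) * (e₀ + e₁) + (B - (e₀ * e₁ + e₀ * e₂ + e₁ * e₂))) = 0 := by
    linear_combination g0 - g1
  have d02 : (e₀ - e₂) * ((A + (e₀ + e₁ + e₂)) * (e₀ + e₂) + (B - (e₀ * e₁ + e₀ * e₂ + e₁ * e₂))) = 0 := by
    linear_combination g0 - g2
  have k01 := (mul_eq_zero.mp d01).resolve_left (sub_ne_zero.mpr h01)
  have k02 := (mul_eq_zero.mp d02).resolve_left (sub_ne_zero.mpr h02)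
  have hs : (A + (e₀ + e₁ + e₂)) * (e₁ - e₂) = 0 := by linear_combination k01 - k02
  have hs0 : A + (e₀ + e₁ + e₂) = 0 := (mul_eq_zero.mp hs).resolve_right (sub_ne_zero.mpr h12)
  have hp0 : B - (e₀ * e₁ + e₀ * e₂ + e₁ * e₂) = 0 := by linear_combination k01 - (e₀ + e₁) * hs0
  have hq0 : C + e₀ * e₁ * e₂ = 0 := by linear_combination g0 - e₀ ^ 2 * hs0 - e₀ * hp0
  linear_combination t ^ 2 * hs0 + t * hp0 + hq0

/-! ## §4 `ℤ_ℓ` bookkeeping: closeness ↔ congruence, values of embeddings -/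

section Padic

variable {K : Type*} [Field K] [NumberField K] {a b c : ℤ} {θ : K} {ℓ : ℕ} [hp : Fact ℓ.Prime]

omit hp in
/-- `‖Q − k‖ ≤ ℓ^{−N}` gives `Q = k + ℓ^N T`. [folklore] -/
theorem exists_eq_add_pow_mul [Fact ℓ.Prime] {Q : ℤ_[ℓ]} {k : ℤ} {N : ℕ}
    (h : ‖Q - (k : ℤ_[ℓ])‖ ≤ (ℓ : ℝ) ^ (-(N : ℤ))) :
    ∃ T : ℤ_[ℓ], Q = (k : ℤ_[ℓ]) + (ℓ : ℤ_[ℓ]) ^ N * T := by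
  obtain ⟨T, hT⟩ := Ideal.mem_span_singleton'.mp ((PadicInt.norm_le_pow_iff_mem_span_pow _ N).mp h)
  refine ⟨T, ?_⟩
  rw [mul_comm, hT]
  ring

omit hp in
/-- Two `ℓ^N`-congruent integers: `k₁ + ℓ^N T₁ = k₂ + ℓ^N T₂` in `ℤ_ℓ` gives `ℓ^N ∣ k₁ − k₂` in `ℤ`. [folklore] -/
theorem pow_dvd_sub_of_eq [Fact ℓ.Prime] {k₁ k₂ : ℤ} {N : ℕ} {T₁ T₂ : ℤ_[ℓ]}
    (h : (k₁ : ℤ_[ℓ]) + (ℓ : ℤ_[ℓ]) ^ N * T₁ = (k₂ : ℤ_[ℓ]) + (ℓ : ℤ_[ℓ]) ^ N * T₂) :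
    (ℓ : ℤ) ^ N ∣ k₁ - k₂ := by
  have hmem : ((k₁ - k₂ : ℤ) : ℤ_[ℓ]) ∈ (Ideal.span {(ℓ : ℤ_[ℓ]) ^ N} : Ideal ℤ_[ℓ]) := by
    refine Ideal.mem_span_singleton'.mpr ⟨T₂ - T₁, ?_⟩
    push_cast
    linear_combination -1 * h
  exact PadicInt.norm_int_le_pow_iff_dvd.mp ((PadicInt.norm_le_pow_iff_mem_span_pow _ N).mpr hmem)

/-- `X(z) ∈ ℤ_ℓ` for a coordinate triple `X` and `z ∈ ℤ_ℓ`. [folklore] -/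
def quadZ (X : ℤ × ℤ × ℤ) (z : ℤ_[ℓ]) : ℤ_[ℓ] := (X.1 : ℤ_[ℓ]) + (X.2.1 : ℤ_[ℓ]) * z + (X.2.2 : ℤ_[ℓ]) * z ^ 2

/-- From `m·u = X(θ)` in `𝓞 K` and `φ(θ) = z`: `m · φ(u) = X(z)`. [folklore] -/
theorem mul_emb_eq_quadZ (hθ : aeval θ (MonicCubic.poly a b c) = 0) (φ : K →+* ℚ_[ℓ]) {z : ℤ_[ℓ]}
    (hφ : φ θ = (z : ℚ_[ℓ])) {m : ℤ} {X : ℤ × ℤ × ℤ} {u : 𝓞 K}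
    (hu : (m : 𝓞 K) * u = TwoDescCubic.lin hθ X.1 X.2.1 X.2.2) :
    (m : ℚ_[ℓ]) * φ (algebraMap (𝓞 K) K u) = (quadZ X z : ℚ_[ℓ]) :=
  TwoDescPadic.emb_mul_eq hθ φ hφ hu

omit hp in
/-- Closeness of the root gives the congruence `X(z) = X(a) + ℓ^N T`. [folklore] -/
theorem exists_quadZ_eq_add [Fact ℓ.Prime] {z : ℤ_[ℓ]} {r : ℤ} {N : ℕ}
    (hz : ‖z - (r : ℤ_[ℓ])‖ ≤ (ℓ : ℝ) ^ (-(N : ℤ))) (X : ℤ × ℤ × ℤ) :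
    ∃ T : ℤ_[ℓ], quadZ X z = (evalInt r X : ℤ_[ℓ]) + (ℓ : ℤ_[ℓ]) ^ N * T := by
  apply exists_eq_add_pow_mul
  have h := TwoDescPadic.norm_quad_sub_le z r X.1 X.2.1 X.2.2
  have hq : TwoDescPadic.quadEval X.1 X.2.1 X.2.2 r = evalInt r X := by
    unfold TwoDescPadic.quadEval evalInt; ring
  rw [hq] at h
  exact h.trans hz

/-! ## §5 The per-point nodal lemma (odd `ℓ`) -/

/-- **NODAL LOCAL CONDITION AT AN ODD SPLIT PRIME.**  With three embeddings `φ_i : K → ℚ_ℓ`,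
`φ_i θ = z_i`, `‖z_i − a_i‖ ≤ ℓ^{−N}`, a root `e ∈ 𝓞 K` of the curve cubic with `m²e = X_t(θ)`, a family
`m² w_j = X_j(θ)` of non-zero `w_j`, a rational point `(x, y)`, `y ≠ 0`, and a subset `U` with
`(x − e)∏_{j∈U} w_j` a square in `K`: if the kernel checks pass (`X_t(a_i)` pairwise distinct,
`nodeDepth ℓ (X_t(a_i)) + 1 ≤ N`, every `X_j(a_i) ≠ 0` with `v_ℓ(X_j(a_i)) < N`), then the kernel's class
vector `uvecOdd ℓ (X_j(a_i)) U` lies in `splitImgOdd ℓ (X_t(a_i))`.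
[cite: Cassels1991LecturesEllipticCurves, §15] -/
theorem uvecOdd_mem_splitImgOdd (S : SqClassMapOdd ℓ) (hℓ : ℓ ≠ 2)
    (hθ : aeval θ (MonicCubic.poly a b c) = 0)
    {z : Fin 3 → ℤ_[ℓ]} {φ : Fin 3 → (K →+* ℚ_[ℓ])} (hφ : ∀ i, φ i θ = (z i : ℚ_[ℓ]))
    {ar : Fin 3 → ℤ} {N : ℕ} (hclose : ∀ i, ‖z i - (ar i : ℤ_[ℓ])‖ ≤ (ℓ : ℝ) ^ (-(N : ℤ)))
    {A B C : ℤ} {m : ℤ} (hm : m ≠ 0) {e : 𝓞 K} {Xt : ℤ × ℤ × ℤ}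
    (he : ((m ^ 2 : ℤ) : 𝓞 K) * e = TwoDescCubic.lin hθ Xt.1 Xt.2.1 Xt.2.2)
    (hroot : e ^ 3 + (A : 𝓞 K) * e ^ 2 + (B : 𝓞 K) * e + (C : 𝓞 K) = 0)
    {ι : Type*} [DecidableEq ι] {w : ι → 𝓞 K} {X : ι → ℤ × ℤ × ℤ}
    (hw : ∀ j, ((m ^ 2 : ℤ) : 𝓞 K) * w j = TwoDescCubic.lin hθ (X j).1 (X j).2.1 (X j).2.2)
    (hw0 : ∀ j, w j ≠ 0)
    {x y : ℚ} (hxy : y ^ 2 = x ^ 3 + A * x ^ 2 + B * x + C) (hy : y ≠ 0)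
    {U : Finset ι}
    (hsq : IsSquare ((algebraMap ℚ K x - algebraMap (𝓞 K) K e) * ∏ j ∈ U, algebraMap (𝓞 K) K (w j)))
    (hdist : ∀ i k : Fin 3, i ≠ k → evalInt (ar i) Xt ≠ evalInt (ar k) Xt)
    (hdepth : nodeDepth ℓ (fun i => evalInt (ar i) Xt) + 1 ≤ N)
    (hprec : ∀ i j, evalInt (ar i) (X j) ≠ 0 ∧ valInt ℓ (evalInt (ar i) (X j)) < N) :
    uvecOdd ℓ (fun i j => evalInt (ar i) (X j)) U ∈ splitImgOdd ℓ (fun i => evalInt (ar i) Xt) := by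
  have hmQ : (m : ℚ_[ℓ]) ≠ 0 := Int.cast_ne_zero.mpr hm
  have hyQ : (y : ℚ_[ℓ]) ≠ 0 := Rat.cast_ne_zero.mpr hy
  -- the scaled roots `m² φ_i(e) = X_t(z_i)` and family values `m² φ_i(w_j) = X_j(z_i)`
  have hQt : ∀ i, ((m ^ 2 : ℤ) : ℚ_[ℓ]) * φ i (algebraMap (𝓞 K) K e) = (quadZ Xt (z i) : ℚ_[ℓ]) :=
    fun i => mul_emb_eq_quadZ hθ (φ i) (hφ i) he
  have hQX : ∀ i j, ((m ^ 2 : ℤ) : ℚ_[ℓ]) * φ i (algebraMap (𝓞 K) K (w j)) = (quadZ (X j) (z i) : ℚ_[ℓ]) :=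
    fun i j => mul_emb_eq_quadZ hθ (φ i) (hφ i) (hw j)
  have hTt : ∀ i, ∃ T : ℤ_[ℓ], quadZ Xt (z i) = (evalInt (ar i) Xt : ℤ_[ℓ]) + (ℓ : ℤ_[ℓ]) ^ N * T :=
    fun i => exists_quadZ_eq_add (hclose i) Xt
  -- the three `φ_i(e)` are roots of `F` in `ℚ_ℓ`, pairwise distinct
  have hrootQ : ∀ i, (φ i (algebraMap (𝓞 K) K e)) ^ 3 + (A : ℚ_[ℓ]) * (φ i (algebraMap (𝓞 K) K e)) ^ 2 +
      (B : ℚ_[ℓ]) * φ i (algebraMap (𝓞 K) K e) + (C : ℚ_[ℓ]) = 0 := by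
    intro i
    have h := congrArg (fun t : 𝓞 K => φ i (algebraMap (𝓞 K) K t)) hroot
    simp only [map_add, map_mul, map_pow, map_intCast, map_zero] at h
    exact h
  have hinj : ∀ i k : Fin 3, i ≠ k → φ i (algebraMap (𝓞 K) K e) ≠ φ k (algebraMap (𝓞 K) K e) := by
    intro i k hik heq
    obtain ⟨Ti, hTi⟩ := hTt i
    obtain ⟨Tk, hTk⟩ := hTt k
    have hq : quadZ Xt (z i) = quadZ Xt (z k) := by
      apply Subtype.ext
      show (quadZ Xt (z i) : ℚ_[ℓ]) = (quadZ Xt (z k) : ℚ_[ℓ])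
      rw [← hQt i, ← hQt k, heq]
    rw [hTi, hTk] at hq
    rcases (pow_dvd_iff_valInt N _).mp (pow_dvd_sub_of_eq hq) with h0 | hle
    · exact hdist i k hik (sub_eq_zero.mp h0)
    · have h1 := valInt_sub_le_nodeDepth (ℓ := ℓ) (fun i => evalInt (ar i) Xt) i k hik
      omega
  have hF := cubic_eq_prod3 (hrootQ 0) (hrootQ 1) (hrootQ 2) (hinj 0 1 (by decide)) (hinj 0 2 (by decide))
    (hinj 1 2 (by decide))
  -- the curve equation in `ℚ_ℓ`, factored, and its scaled form
  have hxyQ : ((y : ℚ_[ℓ])) ^ 2 = (x : ℚ_[ℓ]) ^ 3 + (A : ℚ_[ℓ]) * (x : ℚ_[ℓ]) ^ 2 + (B : ℚ_[ℓ]) * (x : ℚ_[ℓ]) +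
      (C : ℚ_[ℓ]) := by
    have h := congrArg (Rat.cast : ℚ → ℚ_[ℓ]) hxy
    push_cast at h
    exact h
  have hc : ((y : ℚ_[ℓ])) ^ 2 = ((x : ℚ_[ℓ]) - φ 0 (algebraMap (𝓞 K) K e)) *
      ((x : ℚ_[ℓ]) - φ 1 (algebraMap (𝓞 K) K e)) * ((x : ℚ_[ℓ]) - φ 2 (algebraMap (𝓞 K) K e)) :=
    hxyQ.trans (hF _)
  obtain ⟨hx0, hx1, hx2⟩ := ne_zero_of_sq hyQ hc
  have hxe : ∀ i : Fin 3, (x : ℚ_[ℓ]) - φ i (algebraMap (𝓞 K) K e) ≠ 0 := by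
    intro i; fin_cases i
    exacts [hx0, hx1, hx2]
  have hy' : ((m ^ 3 : ℤ) : ℚ_[ℓ]) * (y : ℚ_[ℓ]) ≠ 0 :=
    mul_ne_zero (Int.cast_ne_zero.mpr (pow_ne_zero 3 hm)) hyQ
  have hcurve' : (((m ^ 3 : ℤ) : ℚ_[ℓ]) * (y : ℚ_[ℓ])) ^ 2 =
      (((m ^ 2 : ℤ) : ℚ_[ℓ]) * (x : ℚ_[ℓ]) - (quadZ Xt (z 0) : ℚ_[ℓ])) *
      (((m ^ 2 : ℤ) : ℚ_[ℓ]) * (x : ℚ_[ℓ]) - (quadZ Xt (z 1) : ℚ_[ℓ])) *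
      (((m ^ 2 : ℤ) : ℚ_[ℓ]) * (x : ℚ_[ℓ]) - (quadZ Xt (z 2) : ℚ_[ℓ])) := by
    rw [← hQt 0, ← hQt 1, ← hQt 2]
    push_cast
    linear_combination (m : ℚ_[ℓ]) ^ 6 * hc
  -- the approximations at tree precision `ℓ^(D+1)`
  have happ' : ∀ i, ∃ t : ℤ_[ℓ], quadZ Xt (z i) =
      (evalInt (ar i) Xt : ℤ_[ℓ]) + (ℓ : ℤ_[ℓ]) ^ (nodeDepth ℓ (fun i => evalInt (ar i) Xt) + 1) * t := by
    intro i
    obtain ⟨T, hT⟩ := hTt i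
    obtain ⟨d, hd⟩ := Nat.exists_eq_add_of_le hdepth
    exact ⟨(ℓ : ℤ_[ℓ]) ^ d * T, by rw [hT, hd, pow_add]; ring⟩
  -- M3b on the scaled point
  have hmem := vecOdd_mem_splitImgOdd S hℓ (e := fun i => quadZ Xt (z i)) (ē := fun i => evalInt (ar i) Xt)
    hdist happ' hy' hcurve'
  -- identify the class vector with the kernel's
  have hcls_pt : ∀ i, S.cls (((m ^ 2 : ℤ) : ℚ_[ℓ]) * (x : ℚ_[ℓ]) - (quadZ Xt (z i) : ℚ_[ℓ])) =
      S.cls ((x : ℚ_[ℓ]) - φ i (algebraMap (𝓞 K) K e)) := by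
    intro i
    have h1 : ((m ^ 2 : ℤ) : ℚ_[ℓ]) * (x : ℚ_[ℓ]) - (quadZ Xt (z i) : ℚ_[ℓ]) =
        (m : ℚ_[ℓ]) * (m : ℚ_[ℓ]) * ((x : ℚ_[ℓ]) - φ i (algebraMap (𝓞 K) K e)) := by
      rw [← hQt i]; push_cast; ring
    rw [h1, cls_mul_self_mul S hmQ (hxe i)]
  have hwK0 : ∀ i j, φ i (algebraMap (𝓞 K) K (w j)) ≠ 0 :=
    fun i j => (map_ne_zero (φ i)).mpr (RingOfIntegers.coe_ne_zero_iff.mpr (hw0 j))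
  have hcls_w : ∀ i j, S.cls (φ i (algebraMap (𝓞 K) K (w j))) = bitsInt ℓ (evalInt (ar i) (X j)) := by
    intro i j
    obtain ⟨T, hT⟩ := exists_quadZ_eq_add (hclose i) (X j)
    have h1 : S.cls (((m ^ 2 : ℤ) : ℚ_[ℓ]) * φ i (algebraMap (𝓞 K) K (w j))) = bitsInt ℓ (evalInt (ar i) (X j)) := by
      unfold bitsInt
      apply cls_eq_of_approx S hℓ T (hprec i j).1 (hprec i j).2
      rw [hQX i j, hT]
      push_cast [PadicInt.coe_natCast]
      ring
    have h2 : ((m ^ 2 : ℤ) : ℚ_[ℓ]) * φ i (algebraMap (𝓞 K) K (w j)) =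
        (m : ℚ_[ℓ]) * (m : ℚ_[ℓ]) * φ i (algebraMap (𝓞 K) K (w j)) := by
      push_cast; ring
    rw [h2, cls_mul_self_mul S hmQ (hwK0 i j)] at h1
    exact h1
  have hxK : ∀ i, φ i (algebraMap ℚ K x) = (x : ℚ_[ℓ]) := fun i => by
    rw [eq_ratCast (algebraMap ℚ K) x, map_ratCast]
  have hclsU : ∀ i, S.cls ((x : ℚ_[ℓ]) - φ i (algebraMap (𝓞 K) K e)) =
      uclsOdd ℓ (fun j => evalInt (ar i) (X j)) U := by
    intro i
    have hsqi := hsq.map (φ i)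
    rw [map_mul, map_sub, hxK i, map_prod] at hsqi
    have hprod0 : ∏ j ∈ U, φ i (algebraMap (𝓞 K) K (w j)) ≠ 0 :=
      Finset.prod_ne_zero_iff.mpr fun j _ => hwK0 i j
    rw [cls_eq_of_isSquare_mul S (hxe i) hprod0 hsqi, cls_prod S _ U (fun j _ => hwK0 i j)]
    have hf1 : (fun j => (S.cls (φ i (algebraMap (𝓞 K) K (w j)))).1) =
        fun j => (bitsInt ℓ (evalInt (ar i) (X j))).1 := funext fun j => by rw [hcls_w i j]
    have hf2 : (fun j => (S.cls (φ i (algebraMap (𝓞 K) K (w j)))).2) =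
        fun j => (bitsInt ℓ (evalInt (ar i) (X j))).2 := funext fun j => by rw [hcls_w i j]
    rw [hf1, hf2]
    rfl
  have hvec : vecOdd S (((m ^ 2 : ℤ) : ℚ_[ℓ]) * (x : ℚ_[ℓ])) (fun i => quadZ Xt (z i)) =
      uvecOdd ℓ (fun i j => evalInt (ar i) (X j)) U := by
    unfold vecOdd uvecOdd
    simp only [hcls_pt, hclsU]
  rw [← hvec]
  exact hmem

end Padic

end Summit.BirchSwinnertonDyer.BirchSwinnertonDyer.Rank2Observatory.TwoDescCl.SplitImage

end
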